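import Summits.QuantumFields.BalabanUV.T4Continuum.Support.NE9KerChartCauchyCore

/-!
# NE9KerChartCauchyPointwise — THE KERNELS `𝐄⁽ⁿ⁾(x₁,…,x_n)` OF `F ∘ chart(U)` AT EVERY INDEX TUPLE AND THE BILOCALIZED `(p, q)` TERM OF (4.21)
# IN PRINT'S VOLUME-FREE CURRENCY `|B|²|δB(p)||B′(q)|`, ON ONE BALL FOR EVERY SMALL-BOND BACKGROUND — the SEQUEL of the owner's (F)
# `Support/NE9KerChartCauchyCore` (gen 82: the `iteratedFDeriv` bound and the `ℓ¹`-summed kernel bound at the `cur U` chart), carrying ONLY rows (F)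
# does not export; cell `pub-balaban`, T4-DAG §2 node U3 ∕ §6 NE9, WALL-NE9-P1 §3 (ii) «the kernel species `ker U`», owner plan `KER-SPECIES-PLAN.md`
# K2∕(ii); BINDER row NE9 (owner lineage `b2b-balaban-t4-ne9-p1`); Summits-side NEW leaf by NE9 leaf-01 (`b2b-balaban-t4-ne9-formalise-leaf-01`, gen 77)
# under the owner's INTERFACE REQUEST NE9 #2 extended BY NAME to `NE9KerChartCauchyPointwise.kerCauchy_pointwise_of_small_bonds[_unitary]` (journal
# W-ne9p1-g82-3; ruling e34b3e0c (0)); nothing printed asserted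

HONEST FRAMING (T4-DAG PAGE 1).  Rung (B)+1 of the FINITE-VOLUME T⁴ programme — NOT infinite volume, NOT a mass gap, NOT the Clay problem.  NE9 is a cell
NEW ESTIMATE, NOT PRINTED in [I] = [Balaban1987RG1] (CMP **109**) ∕ [II] = [Balaban1988RG2Cluster] (CMP **116**), NOT PROVED here («NE9 ⇐ the named
binders»; spine PROVED 0∕9).  HONEST DEPENDENCY (cell line, verbatim): continuum YM on T⁴ ⇐ BetaPertH ∧ nine spine estimates (0/9 proved); BetaPertH ⇐
(D1) ∧ (D4) ∧ CAP+tail; G-an2-4 gates asym, D1 and NE2/3/4.  The kernel species `ker` is ONE field of the MODEL O-NE9-1 (ii)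
(`NE9Lemma1KernelSpecies.KerData.ker`); its binder (K) `kerBound` = DECAY × ANALYTICITY ([I] (4.5) p. 282, (4.22) p. 286) PER PAIR `(p, q)`.  THIS FILE IS
THE ANALYTICITY FACTOR IN THE PER-`(p, q)` SHAPE; the decay factor ([Balaban1985Variational] (189)–(190), the lattice-uniformity T-row) is NOT here.

THE PRINT ([I] pp. 282, 285–286; text layer read first-hand this generation).  p. 282: «… can be estimated by B₃∏_{i∈N(p)}|B_i|»; p. 286: «the points x,
x₃ are connected with different sets in a partition, and we apply the identities (4.3) with localizations at the points x, x₃ fixed, i.e. with the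
summations over x, x₃ left undone. A term corresponding to such a partition can be estimated by [E₀ e^{−κd_j(X) − δ₀dist(X,x) − δ₀dist(X,x₃)}]
|B|²|δB(x)||(dB)(Γ_{x,x₃})|».  The configuration space of (4.4) carries the flat sup size `|B|` — in the tree the chart's domain is `NegSize L η levB 0 𝔸`
(weight `(L^{j}η)⁰ = 1`, (F) `norm_symm_eq_of_weight_one`), while `kernelE` ((4.19), `B12Eq419Kernel`) reads functionals on `Bond → 𝔸`.

WHAT THIS FILE PROVES (0 def, 0 sorry, axioms standard; [folklore] composition BY NAME — no inequality of the series asserted as printed).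
* §1 WEIGHT-ONE TRANSPORTS as named lemmas: `levWeight_zero`, `norm_equiv_symm_eq` (:= (F)'s lemma), **`norm_equiv_eq`** (forward isometry),
  `symm_preimage_ball`, **`differentiableOn_comp_symm`** ((Ψ1) ↦ `Φ ∘ e.symm`, Mathlib `comp_right_differentiableOn_iff`), **`mapsTo_comp_symm`** ((Ψ2)) —
  so that ANY exported (Ψ1)(Ψ2) (the host's `Λ := 0` chart, or (SB-A)'s one-instance chart) composes with the Cauchy core in one call.
* §2 ABSTRACT CHART `Φ : NegSize L η lev 0 𝔸 → G` with (Ψ1)(Ψ2) about `0`, `F` holomorphic on `ball 0 R_X` with `‖F‖ ≤ M`, `0 < ρ < R_b`: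
  **`norm_kernelE_chart_apply_le`** (`‖kernelE n (F ∘ Φ ∘ e.symm) 0 xs b‖ ≤ M(n∕ρ)ⁿ∏‖b_k‖` at EVERY index tuple), **`kernelE_chart_zero`** (`KerZero`),
  **`sum_sum_kernelE_four_apply`** — (4.21)'s BILOCALIZATION IS MULTILINEARITY: `Σ_{x₁,x₂}𝐄⁽⁴⁾(p,x₁,x₂,q)[a,B(x₁),B(x₂),c] = D⁴𝐄(b₀)[δ_p a, B, B, δ_q c]`
  (any `𝐄` on the flat space), hence **`norm_sum_sum_kernelE_four_comp_le`** (flat space, (E)'s letters) and **`norm_sum_sum_kernelE_four_chart_le`**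
  (at a chart on `NegSize … 0`): `‖Σ_{x₁,x₂}𝐄⁽⁴⁾(p,x₁,x₂,q)[δB(p),B(x₁),B(x₂),B′(q)]‖ ≤ M(4∕ρ)⁴·‖δB(p)‖·‖B‖²_sup·‖B′(q)‖` — print's p. 286 currency, NO
  volume factor (summing norms instead would cost `|B|₁²`).
* §3 THE INSTANCE AT THE LETTERS of `NE9CurChartUniformBall.cur_chart_exists_of_small_bonds` ((F) thm 1∕2's binders; target `ℂ` as (K)'s `F : E → ℂ`):
  **`kerCauchy_pointwise_of_small_bonds`** ∕ **`_unitary`** — `∃ ε₃ ≤ ε_reg(d,L) ∀ (C₄,a₃) ∃ ε₄ ε_C R_b R′ ∀ U ∀ W: ∃ hpos`, the host's (Ψ1) ∧ (Ψ2) ∧ (Ψ3)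
  KEPT AS CONJUNCTS (a conservative extension of the host face — ONE destructuring serves every consumer; the owner's W-3 ∕ ne9-leaf-02's point), and
  for every old term `F` holomorphic on `ball 0 R′` with `‖F‖ ≤ M` and every `0 < ρ < R_b`: (a) the every-index-tuple bound for ALL `n, xs, b`; (b) for all
  `δB, B, B′ : Bond d m → 𝔸` and END POINTS `p, q`: `‖Σ_{x₁,x₂} kernelE 4 (F ∘ chart_U ∘ e.symm) 0 [p,x₁,x₂,q] [δB p,B x₁,B x₂,B′ q]‖ ≤ M(4∕ρ)⁴‖δB p‖‖B‖²‖B′ q‖`.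
  THE RADII COME BEFORE `∀ U`, so `M(4∕ρ)⁴` is ONE NUMBER for the small-bond family: the MODEL `ker U … p q F := Σ_{x₁,x₂}(…)` has (K) modulo the
  DECAY factor only, `KerZero` by `kernelE_chart_zero`.
NOT RE-EXPORTED ((F) has them): the `iteratedFDeriv` bound and the `ℓ¹`-summed bound.  DISGUISE TEST: composition of landed theorems + one multilinear
identity; finite-lattice numbers (through `R_b`) — NOT print's uniformity in the LATTICE, NOT the decay of (4.5)∕(4.22), NOT (4.17)–(4.18), NOT the (4.6)
insertion frame, NOT the Ward–Takahashi identities, NOT `ker`'s definition, NOT (K)∕(4.22) as printed; not NE9.  Loci: [Balaban1987RG1] (4.2)–(4.5)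
pp. 281–282, (4.19)–(4.22) pp. 285–286; [Balaban1985Variational] (174) p. 305.  Imports (F) ONLY (it carries (E) `B12Eq422KernelCauchy` and
`NE9CurChartUniformBall` v1.2); modifies nothing; no END re-wired.
-/

noncomputable section

open Metric Set Finset
open scoped BigOperators

namespace Summit.QuantumFields.BalabanUV.T4Continuum.NE9KerChartCauchyPointwise

open Literature.MathematicalPhysics.QuantumFieldTheory.Balaban1983to89
open B11Eq115Space B12Eq419Kernel B12Eq422KernelCauchy
open Summit.QuantumFields.BalabanUV.T4Continuum.NE9KerChartCauchyCore (norm_symm_eq_of_weight_one)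

/-! ## §1 The weight-one transports `NegSize L η lev 0 𝔸 ≃L[ℂ] (ι → 𝔸)` as named lemmas -/

section Bridge

variable {ι : Type*} {𝔸 : Type*} [NormedAddCommGroup 𝔸] [NormedSpace ℂ 𝔸] {G : Type*} [NormedAddCommGroup G] [NormedSpace ℂ G]

/-- **Weight one**: the level weight of the size `|·|_{(−0)}` is `(L^{lev x}η)⁰ = 1` — the chart's domain `NegSize L η levB 0 𝔸` carries the flat
sup size `|B|` of [Balaban1987RG1] (4.4). [folklore] -/
theorem levWeight_zero (L η : ℝ) (lev : ι → ℕ) (x : ι) : levWeight L η lev 0 x = 1 := by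
  rw [levWeight_apply, pow_zero]

variable [Fintype ι] {L η : ℝ} [Fact (0 < L)] [Fact (0 < η)] {lev : ι → ℕ}

/-- The inverse identification `(ι → 𝔸) → NegSize L η lev 0 𝔸` is norm-preserving — (F)'s `norm_symm_eq_of_weight_one` at the level
weight `(L^{lev x}η)⁰ = 1`. [folklore] -/
theorem norm_equiv_symm_eq (g : ι → 𝔸) :
    ‖(NegSup.continuousLinearEquiv ℂ (levWeight L η lev 0) (V := 𝔸)).symm g‖ = ‖g‖ :=
  norm_symm_eq_of_weight_one (levWeight L η lev 0) (levWeight_zero L η lev) g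

/-- **The FORWARD isometry**: `‖e f‖ = ‖f‖` for `e := NegSup.continuousLinearEquiv ℂ (levWeight L η lev 0)` — the direction a consumer reading
kernels back on the `NegSize … 0` carrier wants. [folklore] -/
theorem norm_equiv_eq (f : NegSize L η lev 0 𝔸) :
    ‖NegSup.continuousLinearEquiv ℂ (levWeight L η lev 0) f‖ = ‖f‖ := by
  have h := norm_equiv_symm_eq (L := L) (η := η) (lev := lev) (NegSup.continuousLinearEquiv ℂ (levWeight L η lev 0) f)
  rw [ContinuousLinearEquiv.symm_apply_apply] at h; exact h.symm

/-- Balls correspond to balls of the SAME radius under the identification. [folklore] -/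
theorem symm_preimage_ball (x : NegSize L η lev 0 𝔸) (r : ℝ) :
    (NegSup.continuousLinearEquiv ℂ (levWeight L η lev 0) (V := 𝔸)).symm ⁻¹' ball x r =
      ball (NegSup.continuousLinearEquiv ℂ (levWeight L η lev 0) x) r := by
  ext g
  simp only [Set.mem_preimage, mem_ball, dist_eq_norm]
  rw [← norm_equiv_eq (L := L) (η := η) (lev := lev)
    ((NegSup.continuousLinearEquiv ℂ (levWeight L η lev 0) (V := 𝔸)).symm g - x), map_sub,
    ContinuousLinearEquiv.apply_symm_apply]

/-- **(Ψ1) transported**: a chart Fréchet-differentiable on `ball x R_b` of the `NegSize … 0` carrier, read on the flat configuration space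
through the identification, is Fréchet-differentiable on the ball of the same radius about `e x`. [folklore] -/
theorem differentiableOn_comp_symm {Φ : NegSize L η lev 0 𝔸 → G} {x : NegSize L η lev 0 𝔸} {Rb : ℝ}
    (hΦ : DifferentiableOn ℂ Φ (ball x Rb)) :
    DifferentiableOn ℂ (Φ ∘ (NegSup.continuousLinearEquiv ℂ (levWeight L η lev 0) (V := 𝔸)).symm)
      (ball (NegSup.continuousLinearEquiv ℂ (levWeight L η lev 0) x) Rb) := by
  rw [← symm_preimage_ball]
  exact (ContinuousLinearEquiv.comp_right_differentiableOn_iff _).2 hΦ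

omit [NormedAddCommGroup G] [NormedSpace ℂ G] in
/-- **(Ψ2) transported**: the image condition of the chart read through the identification. [folklore] -/
theorem mapsTo_comp_symm {Y : Type*} {Φ : NegSize L η lev 0 𝔸 → Y} {x : NegSize L η lev 0 𝔸} {Rb : ℝ} {T : Set Y}
    (hmaps : MapsTo Φ (ball x Rb) T) :
    MapsTo (Φ ∘ (NegSup.continuousLinearEquiv ℂ (levWeight L η lev 0) (V := 𝔸)).symm)
      (ball (NegSup.continuousLinearEquiv ℂ (levWeight L η lev 0) x) Rb) T := by
  intro g hg
  exact hmaps (show g ∈ (NegSup.continuousLinearEquiv ℂ (levWeight L η lev 0) (V := 𝔸)).symm ⁻¹' ball x Rb by rwa [symm_preimage_ball])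

end Bridge

/-! ## §2 The kernels of `F ∘ Φ` for an abstract chart `Φ` on the `NegSize … 0` carrier -/

section Chart

variable {ι : Type*} [Fintype ι] [DecidableEq ι] {𝔸 : Type*} [NormedAddCommGroup 𝔸] [NormedSpace ℂ 𝔸]
  {G : Type*} [NormedAddCommGroup G] [NormedSpace ℂ G] {F : Type*} [NormedAddCommGroup F] [NormedSpace ℂ F] [CompleteSpace F]
  {L η : ℝ} [Fact (0 < L)] [Fact (0 < η)] {lev : ι → ℕ}

/-- **The kernel values of `F ∘ Φ` are bounded, decay-free, at EVERY index tuple** ([Balaban1987RG1] p. 286 «localizations at the points x, x₃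
fixed»): for `Φ` Fréchet-differentiable on `ball 0 R_b ⊆ NegSize L η lev 0 𝔸` mapping it into `ball 0 R_X`, `F` holomorphic on `ball 0 R_X` with
`‖F‖ ≤ M` there, `0 < ρ < R_b`: `‖kernelE n (F ∘ Φ ∘ e.symm) 0 xs b‖ ≤ M·(n∕ρ)ⁿ·∏‖b_k‖` — the owner's `norm_kernelE_comp_apply_le` after §1. [folklore] -/
theorem norm_kernelE_chart_apply_le {Φ : NegSize L η lev 0 𝔸 → G} {F' : G → F} {Rb RX ρ M : ℝ}
    (hΨ1 : DifferentiableOn ℂ Φ (ball (0 : NegSize L η lev 0 𝔸) Rb))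
    (hΨ2 : MapsTo Φ (ball (0 : NegSize L η lev 0 𝔸) Rb) (ball (0 : G) RX))
    (hF : DifferentiableOn ℂ F' (ball 0 RX)) (hM : ∀ y ∈ ball (0 : G) RX, ‖F' y‖ ≤ M) (hρ : 0 < ρ) (hρR : ρ < Rb)
    (n : ℕ) (xs : Fin n → ι) (b : Fin n → 𝔸) :
    ‖kernelE (𝕜 := ℂ) n (F' ∘ Φ ∘ (NegSup.continuousLinearEquiv ℂ (levWeight L η lev 0) (V := 𝔸)).symm) 0 xs b‖ ≤
      M * ((n : ℝ) / ρ) ^ n * ∏ k, ‖b k‖ := by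
  have h1 := differentiableOn_comp_symm (L := L) (η := η) (lev := lev) hΨ1
  have h2 := mapsTo_comp_symm (L := L) (η := η) (lev := lev) hΨ2
  rw [map_zero] at h1 h2
  exact norm_kernelE_comp_apply_le (Φ := Φ ∘ (NegSup.continuousLinearEquiv ℂ (levWeight L η lev 0) (V := 𝔸)).symm)
    h1 h2 hF hM hρ hρR n xs b

omit [NormedAddCommGroup G] [NormedSpace ℂ G] [CompleteSpace F] in
/-- **`KerZero` at the chart**: the kernels of the ZERO old term composed with any chart vanish (the END `NE9Lemma1KernelSpecies.KerData.KerZero`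
for the MODEL `ker := kernelE 4 (F ∘ chart ∘ e.symm) 0 …`). [folklore] -/
theorem kernelE_chart_zero {G : Type*} (Φ : NegSize L η lev 0 𝔸 → G) (n : ℕ) (xs : Fin n → ι) :
    kernelE (𝕜 := ℂ) n ((0 : G → F) ∘ Φ ∘ (NegSup.continuousLinearEquiv ℂ (levWeight L η lev 0) (V := 𝔸)).symm) 0 xs = 0 :=
  kernelE_comp_zero (Φ ∘ (NegSup.continuousLinearEquiv ℂ (levWeight L η lev 0) (V := 𝔸)).symm) 0 n xs

omit [NormedAddCommGroup G] [NormedSpace ℂ G] [CompleteSpace F] [Fact (0 < L)] [Fact (0 < η)] in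
/-- **(4.21)'s BILOCALIZATION IS MULTILINEARITY** ([Balaban1987RG1] p. 286 «localizations at the points x, x₃ fixed, i.e. with the summations over
x, x₃ left undone»): summing the two MIDDLE points of the four-point kernel against a field `B` re-assembles `B` in those slots —
`Σ_{x₁,x₂} 𝐄⁽⁴⁾(p,x₁,x₂,q)[a, B(x₁), B(x₂), c] = D⁴𝐄(b₀)[δ_p a, B, B, δ_q c]` (a (4.19)-level identity for any `𝐄` on the flat configuration space;
`MultilinearMap.map_update_sum` twice + `Σ_x δ_x B(x) = B`). [folklore] -/
theorem sum_sum_kernelE_four_apply (f : (ι → 𝔸) → F) (b₀ : ι → 𝔸) (p q : ι) (a c : 𝔸) (B : ι → 𝔸) :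
    ∑ x₁, ∑ x₂, kernelE (𝕜 := ℂ) 4 f b₀ ![p, x₁, x₂, q] ![a, B x₁, B x₂, c] =
      iteratedFDeriv ℂ 4 f b₀ ![Pi.single p a, B, B, Pi.single q c] := by
  set A := iteratedFDeriv ℂ 4 f b₀
  have hk : ∀ x₁ x₂, kernelE (𝕜 := ℂ) 4 f b₀ ![p, x₁, x₂, q] ![a, B x₁, B x₂, c] =
      A ![Pi.single p a, Pi.single x₁ (B x₁), Pi.single x₂ (B x₂), Pi.single q c] := by
    intro x₁ x₂; rw [kernelE_apply]; congr 1; funext k; fin_cases k <;> rfl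
  have h2 : ∀ x₁, ∑ x₂, A ![Pi.single p a, Pi.single x₁ (B x₁), Pi.single x₂ (B x₂), Pi.single q c] =
      A ![Pi.single p a, Pi.single x₁ (B x₁), B, Pi.single q c] := by
    intro x₁
    have e : ∀ x₂, (![Pi.single p a, Pi.single x₁ (B x₁), Pi.single x₂ (B x₂), Pi.single q c] : Fin 4 → ι → 𝔸) =
        Function.update ![Pi.single p a, Pi.single x₁ (B x₁), B, Pi.single q c] 2 (Pi.single x₂ (B x₂)) := by
      intro x₂; funext k; fin_cases k <;> simp
    simp_rw [e]
    have h := A.toMultilinearMap.map_update_sum (t := Finset.univ) (2 : Fin 4) (fun x₂ => Pi.single x₂ (B x₂))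
      ![Pi.single p a, Pi.single x₁ (B x₁), B, Pi.single q c]
    simp only [ContinuousMultilinearMap.coe_coe, Finset.univ_sum_single] at h; rw [← h]; congr 1; funext k; fin_cases k <;> simp
  simp_rw [hk, h2]
  have e1 : ∀ x₁, (![Pi.single p a, Pi.single x₁ (B x₁), B, Pi.single q c] : Fin 4 → ι → 𝔸) =
      Function.update ![Pi.single p a, B, B, Pi.single q c] 1 (Pi.single x₁ (B x₁)) := by
    intro x₁; funext k; fin_cases k <;> simp
  simp_rw [e1]
  have h := A.toMultilinearMap.map_update_sum (t := Finset.univ) (1 : Fin 4) (fun x₁ => Pi.single x₁ (B x₁))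
    ![Pi.single p a, B, B, Pi.single q c]
  simp only [ContinuousMultilinearMap.coe_coe, Finset.univ_sum_single] at h; rw [← h]; congr 1; funext k; fin_cases k <;> simp

omit [Fact (0 < L)] [Fact (0 < η)] in
/-- **The BILOCALIZED `(p, q)` bound in print's currency — VOLUME-FREE** ([Balaban1987RG1] p. 286: «A term corresponding to such a partition can be
estimated by … |B|²|δB(x)||(dB)(Γ_{x,x₃})|», `|B|` the sup size (4.17)): for a bounded analytic composite `F ∘ Φ` on the flat configuration space
(the owner's (E) letters), `‖Σ_{x₁,x₂} 𝐄⁽⁴⁾(p,x₁,x₂,q)[δB(p), B(x₁), B(x₂), B′(q)]‖ ≤ M·(4∕ρ)⁴·‖δB(p)‖·‖B‖²_sup·‖B′(q)‖` — NO sum over the middle points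
survives (the identity above + (E)'s Cauchy bound + `‖δ_p a‖ = ‖a‖`). [folklore] -/
theorem norm_sum_sum_kernelE_four_comp_le {Φ : (ι → 𝔸) → G} {F' : G → F} {x : ι → 𝔸} {Rb RX ρ M : ℝ}
    (hΦ : DifferentiableOn ℂ Φ (ball x Rb)) (hmaps : MapsTo Φ (ball x Rb) (ball 0 RX)) (hF : DifferentiableOn ℂ F' (ball 0 RX))
    (hM : ∀ y ∈ ball (0 : G) RX, ‖F' y‖ ≤ M) (hρ : 0 < ρ) (hρR : ρ < Rb) (δB B B' : ι → 𝔸) (p q : ι) :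
    ‖∑ x₁, ∑ x₂, kernelE (𝕜 := ℂ) 4 (F' ∘ Φ) x ![p, x₁, x₂, q] ![δB p, B x₁, B x₂, B' q]‖ ≤
      M * ((4 : ℝ) / ρ) ^ 4 * (‖δB p‖ * ‖B‖ ^ 2 * ‖B' q‖) := by
  rw [sum_sum_kernelE_four_apply]
  refine (ContinuousMultilinearMap.le_opNorm _ _).trans ?_
  refine (mul_le_mul_of_nonneg_right (norm_iteratedFDeriv_comp_le_of_ball hΦ hmaps hF hM hρ hρR 4)
    (Finset.prod_nonneg fun k _ => norm_nonneg _)).trans (le_of_eq ?_)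
  simp only [Fin.prod_univ_four, Matrix.cons_val_zero, Matrix.cons_val_one, Matrix.cons_val]
  rw [Pi.norm_single, Pi.norm_single]
  ring

/-- **The same AT A CHART ON THE `NegSize … 0` CARRIER** (§1's transports + the flat-space bound): for FIXED end points `p` (of `δB`) and `q` (of `B′`),
`‖Σ_{x₁,x₂}‖kernelE 4 (F ∘ Φ ∘ e.symm) 0 [p,x₁,x₂,q] [δB(p), B(x₁), B(x₂), B′(q)]‖ ≤ M·(4∕ρ)⁴·‖δB(p)‖·‖B‖²·‖B′(q)‖` — the `(p, q)`-kernel of the MODEL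
`ker … p q F` before the decay bookkeeping, in print's sup currency. [folklore] -/
theorem norm_sum_sum_kernelE_four_chart_le {Φ : NegSize L η lev 0 𝔸 → G} {F' : G → F} {Rb RX ρ M : ℝ}
    (hΨ1 : DifferentiableOn ℂ Φ (ball (0 : NegSize L η lev 0 𝔸) Rb))
    (hΨ2 : MapsTo Φ (ball (0 : NegSize L η lev 0 𝔸) Rb) (ball (0 : G) RX))
    (hF : DifferentiableOn ℂ F' (ball 0 RX)) (hM : ∀ y ∈ ball (0 : G) RX, ‖F' y‖ ≤ M) (hρ : 0 < ρ) (hρR : ρ < Rb)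
    (δB B B' : ι → 𝔸) (p q : ι) :
    ‖∑ x₁, ∑ x₂, kernelE (𝕜 := ℂ) 4 (F' ∘ Φ ∘ (NegSup.continuousLinearEquiv ℂ (levWeight L η lev 0) (V := 𝔸)).symm) 0 ![p, x₁, x₂, q]
        ![δB p, B x₁, B x₂, B' q]‖ ≤
      M * ((4 : ℝ) / ρ) ^ 4 * (‖δB p‖ * ‖B‖ ^ 2 * ‖B' q‖) := by
  have h1 := differentiableOn_comp_symm (L := L) (η := η) (lev := lev) hΨ1
  have h2 := mapsTo_comp_symm (L := L) (η := η) (lev := lev) hΨ2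
  rw [map_zero] at h1 h2
  exact norm_sum_sum_kernelE_four_comp_le (Φ := Φ ∘ (NegSup.continuousLinearEquiv ℂ (levWeight L η lev 0) (V := 𝔸)).symm)
    h1 h2 hF hM hρ hρR δB B B' p q

end Chart

/-! ## §3 The instance at the letters of the `cur` chart (`NE9CurChartUniformBall.cur_chart_exists_of_small_bonds`), pointwise and bilocalized -/

section CurChart

open B11Eq103H1Complex B11Eq174Chart
open B11Eq111FrakG (nabla115)
open B13Contraction113 (QuadAnalytic)
open B9Eq319QprimeTorus (fineP)
open B9SectCLatticeCarrier (Bond)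
open B7Prop1Explicit (U1)
open B9Eq315QTorus (laplaceAofBackground)
open B9Eq315QTorusOnto (QtorusW_surjective)
open B11Eq44COperatorTorus (Cc)
open B9Eq310HessianOperator (adTransportW)
open Literature.MathematicalPhysics.QuantumFieldTheory.Balaban1983to89.B9Eq335SmallBondsData
  (perCfg_mem_U1 hreg_of_small_bonds alpha_le_64 alphaL_le_half)
open Summit.QuantumFields.BalabanUV.T4Continuum.NE9CurChartUniformBall (cur_chart_exists_of_small_bonds cur_chart_exists_of_small_bonds_unitary)

/-- **THE KERNELS OF `F ∘ chart(U)` AT EVERY INDEX TUPLE AND THE BILOCALIZED `(p, q)` TERM, ON ONE BALL FOR EVERY SMALL-BOND BACKGROUND** — at the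
letters of `cur_chart_exists_of_small_bonds` (its binders verbatim): `∃ hpos`, the host's (Ψ1) ∧ (Ψ2) ∧ (Ψ3) kept as conjuncts, and for every old term
`F : Space115 … (∇_U) → ℂ` holomorphic on `ball 0 R′` with `‖F‖ ≤ M` there and every `0 < ρ < R_b`: (a) `‖kernelE n (F ∘ chart_U ∘ e.symm) 0 xs b‖ ≤
M(n∕ρ)ⁿ∏‖b_k‖` for all `n, xs, b`; (b) `‖Σ_{x₁,x₂} kernelE 4 (…) 0 [p,x₁,x₂,q] [δB p, B x₁, B x₂, B′ q]‖ ≤ M(4∕ρ)⁴‖δB p‖‖B‖²‖B′ q‖` for all fields and end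
points — the per-`(p, q)` analyticity half of (K) `kerBound` for the MODEL `ker U … p q F := Σ_{x₁,x₂}(…)`, MODULO THE DECAY FACTOR, ONE constant for the
whole small-bond family (radii before `∀ U`).  NOT the decay of (4.5)∕(4.22); NOT (4.17)–(4.18); NOT (K)∕(4.22) as printed. [folklore] -/
theorem kerCauchy_pointwise_of_small_bonds {d : ℕ} (L : ℕ) [NeZero L] (m : Fin d → ℕ) [∀ i, NeZero (fineP L m i)] (hL : 1 ≤ L)
    {𝔸 : Type*} [NormedRing 𝔸] [NormedAlgebra ℂ 𝔸] [CompleteSpace 𝔸] [NormOneClass 𝔸] [StarRing 𝔸] [NormedStarGroup 𝔸] [StarModule ℂ 𝔸]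
    [FiniteDimensional ℂ 𝔸]
    {W : Type*} [NormedAddCommGroup W] [InnerProductSpace ℂ W] [FiniteDimensional ℂ W] (φ : W ≃ₗ[ℂ] 𝔸) {Mφ Mφ' : ℝ} (hMφ : 0 ≤ Mφ)
    (hMφ' : 0 ≤ Mφ') (hφ : ∀ w, ‖φ w‖ ≤ Mφ * ‖w‖) (hφ' : ∀ X, ‖φ.symm X‖ ≤ Mφ' * ‖X‖)
    (τ : 𝔸 →ₗ[ℂ] ℂ) {Cτ : ℝ} (hτ : ∀ X, ‖τ X‖ ≤ Cτ * ‖X‖) (hCτ : 0 ≤ Cτ)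
    {η : ℝ} [Fact (0 < (L : ℝ))] [Fact (0 < η)] {lev₀ : Bond d (fineP L m) → ℕ} {levB : Bond d m → ℕ} (lev₁ : Bond d (fineP L m) × Fin d → ℕ)
    (hlev : ∀ b, 1 ≤ lev₀ b) {c₀ c₁ : ℝ} [Fact (0 < c₀)] [Fact (0 < c₁)] {a : ℝ} (ha : 0 < a) :
    ∃ ε₃ : ℝ, 0 < ε₃ ∧ ε₃ ≤ 1 / (256 * ((d : ℝ) + 1) ^ 2 * (L : ℝ) ^ (d + 1)) ∧ ∀ {C₄ a₃ : ℝ}, 0 ≤ C₄ → 0 < a₃ →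
      ∃ ε₄ εC Rb R' : ℝ, 0 < Rb ∧ 0 < R' ∧ ∀ (U : Bond d (fineP L m) → 𝔸ˣ) (hU : ∀ b, U b ∈ U1 𝔸) {ε : ℝ} (hε : 0 ≤ ε)
      (hεr : ε ≤ 1 / (256 * ((d : ℝ) + 1) ^ 2 * (L : ℝ) ^ (d + 1))), ε ≤ ε₃ → ∀ (hUε : ∀ b, ‖(U b : 𝔸) - 1‖ ≤ ε),
      (∀ (b : Bond d (fineP L m)) (v u : W), inner ℂ (adTransportW φ U b v) u = inner ℂ v (adTransportW φ (fun b => (U b)⁻¹) b u)) →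
      ∀ {Wq : Space115 (L : ℝ) η lev₀ lev₁ (nabla115 η U) → NegSize (L : ℝ) η lev₀ 3 𝔸}, QuadAnalytic Wq C₄ a₃ →
        AnalyticOnNhd ℂ Wq {Y | ‖Y‖ < a₃} →
      ∃ hpos : ∀ x : BondL2K ℂ d (fineP L m) c₀ W, x ≠ 0 →
          0 < RCLike.re (inner ℂ x (laplaceAofBackground L m hL φ U (alpha_le_64 hL hε hεr) (perCfg_mem_U1 L m hU)
            (hreg_of_small_bonds L m hU hε hUε) τ η (c₀ := c₀) (c₁ := c₁) a x)),
        DifferentiableOn ℂ (chartHB (frakGLatticeCLM (lev₀ := lev₀) φ hpos (QtorusW_surjective L m hL U (alpha_le_64 hL hε hεr)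
              (perCfg_mem_U1 L m hU) (hreg_of_small_bonds L m hU hε hUε) (alphaL_le_half hL hεr) φ) lev₁ (nabla115 η U))
            0 Wq 0 (fun A' => A' + solA (H1LatticeCLM (lev₀ := lev₀) (levB := levB) φ hpos (QtorusW_surjective L m hL U (alpha_le_64 hL hε hεr)
              (perCfg_mem_U1 L m hU) (hreg_of_small_bonds L m hU hε hUε) (alphaL_le_half hL hεr) φ) lev₁ (nabla115 η U))
              0 (Cc L m η U lev₀ lev₁ (nabla115 η U) levB) 0 εC A') ε₄
            (H1LatticeCLM (lev₀ := lev₀) (levB := levB) φ hpos (QtorusW_surjective L m hL U (alpha_le_64 hL hε hεr) (perCfg_mem_U1 L m hU)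
              (hreg_of_small_bonds L m hU hε hUε) (alphaL_le_half hL hεr) φ) lev₁ (nabla115 η U)))
          (ball (0 : NegSize (L : ℝ) η levB 0 𝔸) Rb) ∧
        MapsTo (chartHB (frakGLatticeCLM (lev₀ := lev₀) φ hpos (QtorusW_surjective L m hL U (alpha_le_64 hL hε hεr)
              (perCfg_mem_U1 L m hU) (hreg_of_small_bonds L m hU hε hUε) (alphaL_le_half hL hεr) φ) lev₁ (nabla115 η U))
            0 Wq 0 (fun A' => A' + solA (H1LatticeCLM (lev₀ := lev₀) (levB := levB) φ hpos (QtorusW_surjective L m hL U (alpha_le_64 hL hε hεr)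
              (perCfg_mem_U1 L m hU) (hreg_of_small_bonds L m hU hε hUε) (alphaL_le_half hL hεr) φ) lev₁ (nabla115 η U))
              0 (Cc L m η U lev₀ lev₁ (nabla115 η U) levB) 0 εC A') ε₄
            (H1LatticeCLM (lev₀ := lev₀) (levB := levB) φ hpos (QtorusW_surjective L m hL U (alpha_le_64 hL hε hεr) (perCfg_mem_U1 L m hU)
              (hreg_of_small_bonds L m hU hε hUε) (alphaL_le_half hL hεr) φ) lev₁ (nabla115 η U)))
          (ball (0 : NegSize (L : ℝ) η levB 0 𝔸) Rb) (ball (0 : Space115 (L : ℝ) η lev₀ lev₁ (nabla115 η U)) R') ∧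
        chartHB (frakGLatticeCLM (lev₀ := lev₀) φ hpos (QtorusW_surjective L m hL U (alpha_le_64 hL hε hεr)
              (perCfg_mem_U1 L m hU) (hreg_of_small_bonds L m hU hε hUε) (alphaL_le_half hL hεr) φ) lev₁ (nabla115 η U))
            0 Wq 0 (fun A' => A' + solA (H1LatticeCLM (lev₀ := lev₀) (levB := levB) φ hpos (QtorusW_surjective L m hL U (alpha_le_64 hL hε hεr)
              (perCfg_mem_U1 L m hU) (hreg_of_small_bonds L m hU hε hUε) (alphaL_le_half hL hεr) φ) lev₁ (nabla115 η U))
              0 (Cc L m η U lev₀ lev₁ (nabla115 η U) levB) 0 εC A') ε₄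
            (H1LatticeCLM (lev₀ := lev₀) (levB := levB) φ hpos (QtorusW_surjective L m hL U (alpha_le_64 hL hε hεr) (perCfg_mem_U1 L m hU)
              (hreg_of_small_bonds L m hU hε hUε) (alphaL_le_half hL hεr) φ) lev₁ (nabla115 η U)) 0 = 0 ∧
        ∀ (F' : Space115 (L : ℝ) η lev₀ lev₁ (nabla115 η U) → ℂ) (M : ℝ),
          DifferentiableOn ℂ F' (ball (0 : Space115 (L : ℝ) η lev₀ lev₁ (nabla115 η U)) R') →
          (∀ y ∈ ball (0 : Space115 (L : ℝ) η lev₀ lev₁ (nabla115 η U)) R', ‖F' y‖ ≤ M) →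
          ∀ {ρ : ℝ}, 0 < ρ → ρ < Rb →
        (∀ (n : ℕ) (xs : Fin n → Bond d m) (b : Fin n → 𝔸),
          ‖kernelE (𝕜 := ℂ) n (F' ∘ chartHB (frakGLatticeCLM (lev₀ := lev₀) φ hpos (QtorusW_surjective L m hL U (alpha_le_64 hL hε hεr)
              (perCfg_mem_U1 L m hU) (hreg_of_small_bonds L m hU hε hUε) (alphaL_le_half hL hεr) φ) lev₁ (nabla115 η U))
            0 Wq 0 (fun A' => A' + solA (H1LatticeCLM (lev₀ := lev₀) (levB := levB) φ hpos (QtorusW_surjective L m hL U (alpha_le_64 hL hε hεr)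
              (perCfg_mem_U1 L m hU) (hreg_of_small_bonds L m hU hε hUε) (alphaL_le_half hL hεr) φ) lev₁ (nabla115 η U))
              0 (Cc L m η U lev₀ lev₁ (nabla115 η U) levB) 0 εC A') ε₄
            (H1LatticeCLM (lev₀ := lev₀) (levB := levB) φ hpos (QtorusW_surjective L m hL U (alpha_le_64 hL hε hεr) (perCfg_mem_U1 L m hU)
              (hreg_of_small_bonds L m hU hε hUε) (alphaL_le_half hL hεr) φ) lev₁ (nabla115 η U)) ∘
            (NegSup.continuousLinearEquiv ℂ (levWeight (L : ℝ) η levB 0) (V := 𝔸)).symm) 0 xs b‖ ≤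
            M * ((n : ℝ) / ρ) ^ n * ∏ k, ‖b k‖) ∧
        (∀ (δB B B' : Bond d m → 𝔸) (p q : Bond d m),
          ‖∑ x₁, ∑ x₂, kernelE (𝕜 := ℂ) 4 (F' ∘ chartHB (frakGLatticeCLM (lev₀ := lev₀) φ hpos (QtorusW_surjective L m hL U
              (alpha_le_64 hL hε hεr) (perCfg_mem_U1 L m hU) (hreg_of_small_bonds L m hU hε hUε) (alphaL_le_half hL hεr) φ) lev₁ (nabla115 η U))
            0 Wq 0 (fun A' => A' + solA (H1LatticeCLM (lev₀ := lev₀) (levB := levB) φ hpos (QtorusW_surjective L m hL U (alpha_le_64 hL hε hεr)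
              (perCfg_mem_U1 L m hU) (hreg_of_small_bonds L m hU hε hUε) (alphaL_le_half hL hεr) φ) lev₁ (nabla115 η U))
              0 (Cc L m η U lev₀ lev₁ (nabla115 η U) levB) 0 εC A') ε₄
            (H1LatticeCLM (lev₀ := lev₀) (levB := levB) φ hpos (QtorusW_surjective L m hL U (alpha_le_64 hL hε hεr) (perCfg_mem_U1 L m hU)
              (hreg_of_small_bonds L m hU hε hUε) (alphaL_le_half hL hεr) φ) lev₁ (nabla115 η U)) ∘
            (NegSup.continuousLinearEquiv ℂ (levWeight (L : ℝ) η levB 0) (V := 𝔸)).symm) 0 ![p, x₁, x₂, q]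
              ![δB p, B x₁, B x₂, B' q]‖ ≤
            M * ((4 : ℝ) / ρ) ^ 4 * (‖δB p‖ * ‖B‖ ^ 2 * ‖B' q‖)) := by
  obtain ⟨ε₃, hε₃, hle, H⟩ := cur_chart_exists_of_small_bonds L m hL φ hMφ hMφ' hφ hφ' τ hτ hCτ (η := η) (levB := levB) lev₁ hlev
    (c₀ := c₀) (c₁ := c₁) ha
  refine ⟨ε₃, hε₃, hle, fun {C₄ a₃} hC₄ ha₃ => ?_⟩
  obtain ⟨ε₄, εC, Rb, R', hRb0, hR'0, H'⟩ := H hC₄ ha₃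
  refine ⟨ε₄, εC, Rb, R', hRb0, hR'0, ?_⟩
  intro U hU ε hε hεr hεm hUε hRS Wq hW hWa
  obtain ⟨hpos, hΨ1, hΨ2, hΨ3⟩ := H' U hU hε hεr hεm hUε hRS hW hWa
  refine ⟨hpos, hΨ1, hΨ2, hΨ3, fun F' M hF hM ρ hρ hρR => ⟨fun n xs b => ?_, fun δB B B' p q => ?_⟩⟩
  · exact norm_kernelE_chart_apply_le (L := (L : ℝ)) (η := η) (lev := levB) hΨ1 hΨ2 hF hM hρ hρR n xs b
  · exact norm_sum_sum_kernelE_four_chart_le (L := (L : ℝ)) (η := η) (lev := levB) hΨ1 hΨ2 hF hM hρ hρR δB B B' p q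

/-- **The same with `hRS` DISCHARGED BY THE MODEL LETTERS** (`cur_chart_exists_of_small_bonds_unitary`: unitary bond variables, tracial `τ`, the
norming `⟨φ⁻¹X, φ⁻¹Y⟩ = τ(X*Y)`) — background binders {`U(b) ∈ U1`, `U(b)` unitary, `‖U(b) − 1‖ ≤ ε ≤ ε₃`} and nothing else. [folklore] -/
theorem kerCauchy_pointwise_of_small_bonds_unitary {d : ℕ} (L : ℕ) [NeZero L] (m : Fin d → ℕ) [∀ i, NeZero (fineP L m i)] (hL : 1 ≤ L)
    {𝔸 : Type*} [NormedRing 𝔸] [NormedAlgebra ℂ 𝔸] [CompleteSpace 𝔸] [NormOneClass 𝔸] [StarRing 𝔸] [NormedStarGroup 𝔸] [StarModule ℂ 𝔸]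
    [FiniteDimensional ℂ 𝔸]
    {W : Type*} [NormedAddCommGroup W] [InnerProductSpace ℂ W] [FiniteDimensional ℂ W] (φ : W ≃ₗ[ℂ] 𝔸) {Mφ Mφ' : ℝ} (hMφ : 0 ≤ Mφ)
    (hMφ' : 0 ≤ Mφ') (hφ : ∀ w, ‖φ w‖ ≤ Mφ * ‖w‖) (hφ' : ∀ X, ‖φ.symm X‖ ≤ Mφ' * ‖X‖)
    (τ : 𝔸 →ₗ[ℂ] ℂ) {Cτ : ℝ} (hτ : ∀ X, ‖τ X‖ ≤ Cτ * ‖X‖) (hCτ : 0 ≤ Cτ)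
    (hτφ : ∀ X Y : 𝔸, inner ℂ (φ.symm X) (φ.symm Y) = τ (star X * Y)) (htr : ∀ X Y : 𝔸, τ (X * Y) = τ (Y * X))
    {η : ℝ} [Fact (0 < (L : ℝ))] [Fact (0 < η)] {lev₀ : Bond d (fineP L m) → ℕ} {levB : Bond d m → ℕ} (lev₁ : Bond d (fineP L m) × Fin d → ℕ)
    (hlev : ∀ b, 1 ≤ lev₀ b) {c₀ c₁ : ℝ} [Fact (0 < c₀)] [Fact (0 < c₁)] {a : ℝ} (ha : 0 < a) :
    ∃ ε₃ : ℝ, 0 < ε₃ ∧ ε₃ ≤ 1 / (256 * ((d : ℝ) + 1) ^ 2 * (L : ℝ) ^ (d + 1)) ∧ ∀ {C₄ a₃ : ℝ}, 0 ≤ C₄ → 0 < a₃ →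
      ∃ ε₄ εC Rb R' : ℝ, 0 < Rb ∧ 0 < R' ∧ ∀ (U : Bond d (fineP L m) → 𝔸ˣ) (hU : ∀ b, U b ∈ U1 𝔸) {ε : ℝ} (hε : 0 ≤ ε)
      (hεr : ε ≤ 1 / (256 * ((d : ℝ) + 1) ^ 2 * (L : ℝ) ^ (d + 1))), ε ≤ ε₃ → ∀ (hUε : ∀ b, ‖(U b : 𝔸) - 1‖ ≤ ε),
      (∀ b, star (U b : 𝔸) = (((U b)⁻¹ : 𝔸ˣ) : 𝔸)) →
      ∀ {Wq : Space115 (L : ℝ) η lev₀ lev₁ (nabla115 η U) → NegSize (L : ℝ) η lev₀ 3 𝔸}, QuadAnalytic Wq C₄ a₃ →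
        AnalyticOnNhd ℂ Wq {Y | ‖Y‖ < a₃} →
      ∃ hpos : ∀ x : BondL2K ℂ d (fineP L m) c₀ W, x ≠ 0 →
          0 < RCLike.re (inner ℂ x (laplaceAofBackground L m hL φ U (alpha_le_64 hL hε hεr) (perCfg_mem_U1 L m hU)
            (hreg_of_small_bonds L m hU hε hUε) τ η (c₀ := c₀) (c₁ := c₁) a x)),
        DifferentiableOn ℂ (chartHB (frakGLatticeCLM (lev₀ := lev₀) φ hpos (QtorusW_surjective L m hL U (alpha_le_64 hL hε hεr)
              (perCfg_mem_U1 L m hU) (hreg_of_small_bonds L m hU hε hUε) (alphaL_le_half hL hεr) φ) lev₁ (nabla115 η U))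
            0 Wq 0 (fun A' => A' + solA (H1LatticeCLM (lev₀ := lev₀) (levB := levB) φ hpos (QtorusW_surjective L m hL U (alpha_le_64 hL hε hεr)
              (perCfg_mem_U1 L m hU) (hreg_of_small_bonds L m hU hε hUε) (alphaL_le_half hL hεr) φ) lev₁ (nabla115 η U))
              0 (Cc L m η U lev₀ lev₁ (nabla115 η U) levB) 0 εC A') ε₄
            (H1LatticeCLM (lev₀ := lev₀) (levB := levB) φ hpos (QtorusW_surjective L m hL U (alpha_le_64 hL hε hεr) (perCfg_mem_U1 L m hU)
              (hreg_of_small_bonds L m hU hε hUε) (alphaL_le_half hL hεr) φ) lev₁ (nabla115 η U)))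
          (ball (0 : NegSize (L : ℝ) η levB 0 𝔸) Rb) ∧
        MapsTo (chartHB (frakGLatticeCLM (lev₀ := lev₀) φ hpos (QtorusW_surjective L m hL U (alpha_le_64 hL hε hεr)
              (perCfg_mem_U1 L m hU) (hreg_of_small_bonds L m hU hε hUε) (alphaL_le_half hL hεr) φ) lev₁ (nabla115 η U))
            0 Wq 0 (fun A' => A' + solA (H1LatticeCLM (lev₀ := lev₀) (levB := levB) φ hpos (QtorusW_surjective L m hL U (alpha_le_64 hL hε hεr)
              (perCfg_mem_U1 L m hU) (hreg_of_small_bonds L m hU hε hUε) (alphaL_le_half hL hεr) φ) lev₁ (nabla115 η U))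
              0 (Cc L m η U lev₀ lev₁ (nabla115 η U) levB) 0 εC A') ε₄
            (H1LatticeCLM (lev₀ := lev₀) (levB := levB) φ hpos (QtorusW_surjective L m hL U (alpha_le_64 hL hε hεr) (perCfg_mem_U1 L m hU)
              (hreg_of_small_bonds L m hU hε hUε) (alphaL_le_half hL hεr) φ) lev₁ (nabla115 η U)))
          (ball (0 : NegSize (L : ℝ) η levB 0 𝔸) Rb) (ball (0 : Space115 (L : ℝ) η lev₀ lev₁ (nabla115 η U)) R') ∧
        chartHB (frakGLatticeCLM (lev₀ := lev₀) φ hpos (QtorusW_surjective L m hL U (alpha_le_64 hL hε hεr)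
              (perCfg_mem_U1 L m hU) (hreg_of_small_bonds L m hU hε hUε) (alphaL_le_half hL hεr) φ) lev₁ (nabla115 η U))
            0 Wq 0 (fun A' => A' + solA (H1LatticeCLM (lev₀ := lev₀) (levB := levB) φ hpos (QtorusW_surjective L m hL U (alpha_le_64 hL hε hεr)
              (perCfg_mem_U1 L m hU) (hreg_of_small_bonds L m hU hε hUε) (alphaL_le_half hL hεr) φ) lev₁ (nabla115 η U))
              0 (Cc L m η U lev₀ lev₁ (nabla115 η U) levB) 0 εC A') ε₄
            (H1LatticeCLM (lev₀ := lev₀) (levB := levB) φ hpos (QtorusW_surjective L m hL U (alpha_le_64 hL hε hεr) (perCfg_mem_U1 L m hU)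
              (hreg_of_small_bonds L m hU hε hUε) (alphaL_le_half hL hεr) φ) lev₁ (nabla115 η U)) 0 = 0 ∧
        ∀ (F' : Space115 (L : ℝ) η lev₀ lev₁ (nabla115 η U) → ℂ) (M : ℝ),
          DifferentiableOn ℂ F' (ball (0 : Space115 (L : ℝ) η lev₀ lev₁ (nabla115 η U)) R') →
          (∀ y ∈ ball (0 : Space115 (L : ℝ) η lev₀ lev₁ (nabla115 η U)) R', ‖F' y‖ ≤ M) →
          ∀ {ρ : ℝ}, 0 < ρ → ρ < Rb →
        (∀ (n : ℕ) (xs : Fin n → Bond d m) (b : Fin n → 𝔸),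
          ‖kernelE (𝕜 := ℂ) n (F' ∘ chartHB (frakGLatticeCLM (lev₀ := lev₀) φ hpos (QtorusW_surjective L m hL U (alpha_le_64 hL hε hεr)
              (perCfg_mem_U1 L m hU) (hreg_of_small_bonds L m hU hε hUε) (alphaL_le_half hL hεr) φ) lev₁ (nabla115 η U))
            0 Wq 0 (fun A' => A' + solA (H1LatticeCLM (lev₀ := lev₀) (levB := levB) φ hpos (QtorusW_surjective L m hL U (alpha_le_64 hL hε hεr)
              (perCfg_mem_U1 L m hU) (hreg_of_small_bonds L m hU hε hUε) (alphaL_le_half hL hεr) φ) lev₁ (nabla115 η U))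
              0 (Cc L m η U lev₀ lev₁ (nabla115 η U) levB) 0 εC A') ε₄
            (H1LatticeCLM (lev₀ := lev₀) (levB := levB) φ hpos (QtorusW_surjective L m hL U (alpha_le_64 hL hε hεr) (perCfg_mem_U1 L m hU)
              (hreg_of_small_bonds L m hU hε hUε) (alphaL_le_half hL hεr) φ) lev₁ (nabla115 η U)) ∘
            (NegSup.continuousLinearEquiv ℂ (levWeight (L : ℝ) η levB 0) (V := 𝔸)).symm) 0 xs b‖ ≤
            M * ((n : ℝ) / ρ) ^ n * ∏ k, ‖b k‖) ∧
        (∀ (δB B B' : Bond d m → 𝔸) (p q : Bond d m),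
          ‖∑ x₁, ∑ x₂, kernelE (𝕜 := ℂ) 4 (F' ∘ chartHB (frakGLatticeCLM (lev₀ := lev₀) φ hpos (QtorusW_surjective L m hL U
              (alpha_le_64 hL hε hεr) (perCfg_mem_U1 L m hU) (hreg_of_small_bonds L m hU hε hUε) (alphaL_le_half hL hεr) φ) lev₁ (nabla115 η U))
            0 Wq 0 (fun A' => A' + solA (H1LatticeCLM (lev₀ := lev₀) (levB := levB) φ hpos (QtorusW_surjective L m hL U (alpha_le_64 hL hε hεr)
              (perCfg_mem_U1 L m hU) (hreg_of_small_bonds L m hU hε hUε) (alphaL_le_half hL hεr) φ) lev₁ (nabla115 η U))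
              0 (Cc L m η U lev₀ lev₁ (nabla115 η U) levB) 0 εC A') ε₄
            (H1LatticeCLM (lev₀ := lev₀) (levB := levB) φ hpos (QtorusW_surjective L m hL U (alpha_le_64 hL hε hεr) (perCfg_mem_U1 L m hU)
              (hreg_of_small_bonds L m hU hε hUε) (alphaL_le_half hL hεr) φ) lev₁ (nabla115 η U)) ∘
            (NegSup.continuousLinearEquiv ℂ (levWeight (L : ℝ) η levB 0) (V := 𝔸)).symm) 0 ![p, x₁, x₂, q]
              ![δB p, B x₁, B x₂, B' q]‖ ≤
            M * ((4 : ℝ) / ρ) ^ 4 * (‖δB p‖ * ‖B‖ ^ 2 * ‖B' q‖)) := by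
  obtain ⟨ε₃, hε₃, hle, H⟩ := cur_chart_exists_of_small_bonds_unitary L m hL φ hMφ hMφ' hφ hφ' τ hτ hCτ hτφ htr (η := η)
    (levB := levB) lev₁ hlev (c₀ := c₀) (c₁ := c₁) ha
  refine ⟨ε₃, hε₃, hle, fun {C₄ a₃} hC₄ ha₃ => ?_⟩
  obtain ⟨ε₄, εC, Rb, R', hRb0, hR'0, H'⟩ := H hC₄ ha₃
  refine ⟨ε₄, εC, Rb, R', hRb0, hR'0, ?_⟩
  intro U hU ε hε hεr hεm hUε hUstar Wq hW hWa
  obtain ⟨hpos, hΨ1, hΨ2, hΨ3⟩ := H' U hU hε hεr hεm hUε hUstar hW hWa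
  refine ⟨hpos, hΨ1, hΨ2, hΨ3, fun F' M hF hM ρ hρ hρR => ⟨fun n xs b => ?_, fun δB B B' p q => ?_⟩⟩
  · exact norm_kernelE_chart_apply_le (L := (L : ℝ)) (η := η) (lev := levB) hΨ1 hΨ2 hF hM hρ hρR n xs b
  · exact norm_sum_sum_kernelE_four_chart_le (L := (L : ℝ)) (η := η) (lev := levB) hΨ1 hΨ2 hF hM hρ hρR δB B B' p q

end CurChart

end Summit.QuantumFields.BalabanUV.T4Continuum.NE9KerChartCauchyPointwise

end
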